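import Literature.Topology.FourManifolds.HomotopySpheresGroupAssembly
import Literature.Topology.FourManifolds.BallRemovalCobordism
import Literature.Topology.FourManifolds.SmoothPoincareLowDim
import HarnessLib

/-!
# The group `Θₙ`: Kervaire–Milnor's Theorem 1.1 from the current leaves (continued)

Sibling proofs file of `HomotopySpheresGroup.lean` / `HomotopySpheresGroupProofs.lean` /
`HomotopySpheresGroupAssembly.lean`, the decomposition of the named fact
`Literature.Topology.FourManifolds.exists_commGroup_homotopySphereClass` (Kervaire–Milnor's
Theorem 1.1, *Groups of homotopy spheres I*, Ann. of Math. 77 (1963), for the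
oriented-diffeomorphism classes `Θₙ = HomotopySphereClass n`, `n ≠ 0, 4`). Two book-keeping steps
on top of `exists_commGroup_homotopySphereClass_of_leaves'` (six named facts):

* the smooth half of Lemma 2.3 — removing an open ball from a bounding manifold gives a cobordism
  to `Sⁿ`, leaf (vii-a) `NullCobordism.exists_cobordism_sphere_compl_ball` — is now a theorem of
  the tree (`NullCobordism.exists_cobordism_sphere_homeomorph_compl_ball`, `BallRemovalCobordism.lean`;
  its `_holds` form is in `HomotopySpheresInverseProofs.lean`) and is fed in
  (`HomotopySphere.isHCobordant_sphere_of_isOrientedConnectedSum_neg_of_leaves`);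
* the low-dimensional input is sharpened. The earlier assemblies take the tree fact
  `Literature.Topology.FourManifolds.nonemptyDiffeomorphSphere_of_mem` (spc4.S32: the smooth
  Poincaré conjecture in ALL the dimensions `1, 2, 3, 5, 6, 12, 56, 61` in which it is known,
  Kervaire–Milnor 1963 and Wang–Xu 2017), but consume it in dimensions `1, 2, 3` only
  (Kervaire–Milnor, p. 507: "Clearly `Θ₁` is zero … It follows that `Θ₂ = 0`. If the Poincaré
  hypothesis were proved, it would follow that `Θ₃` is zero"). Since the dimensions `≥ 5` of
  spc4.S32 are themselves consequences of the structure of `Θₙ` (Part II of Kervaire–Milnor;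
  Wang–Xu), they must not be an input of Theorem 1.1: here the hypothesis is exactly the smooth
  Poincaré conjecture in dimensions `1 ≤ n ≤ 3` (`exists_commGroup_homotopySphereClass_of_groupLawFacts'`,
  `exists_commGroup_homotopySphereClass_of_fiveLeaves`), and the spc4.S32 form is recovered as a
  corollary (`exists_commGroup_homotopySphereClass_of_fiveLeaves'`).

Result: `Literature.Topology.FourManifolds.exists_commGroup_homotopySphereClass_of_fiveLeaves` —
Theorem 1.1 for `Θₙ`, `n ≠ 0, 4`, from FIVE inputs: (i') the smooth Poincaré conjecture in
dimensions `1, 2, 3` (classification of curves and surfaces; Perelman); (iii'') the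
Whitehead–Hurewicz recognition of contractible manifolds
(`Literature.AlgebraicTopology.Homotopy.Manifold.contractibleSpace_of_simplyConnected_of_acyclic`);
(vii-b) the homotopy theory in the proof of Lemma 2.3
(`NullCobordism.isHomotopyEquiv_compl_ball_of_contractibleSpace`); (vii-c) Kervaire–Milnor's
rotation construction in the proof of Lemma 2.4
(`HomotopySphere.exists_nullCobordism_isOrientedConnectedSum_neg`); (viii) Smale's h-cobordism
theorem (`nonempty_diffeomorph_of_isHCobordant_of_five_le`, spc4.S15). No statement of the
sibling files is changed; the one definition of this file is the named fact
`exists_commGroup_homotopySphereClass_of_ne_three` below.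

With the low-dimensional statements separated (`SmoothPoincareLowDim.lean`: the named facts
`nonemptyDiffeomorphSphere_one`, `nonemptyDiffeomorphSphere_two` — classification of curves and
surfaces — and spc4.S31 `nonempty_diffeomorph_sphere_three` — Perelman — in the spc4.S32 shape),
the inputs of Theorem 1.1 are finally sorted by what the source covers:

* `Literature.Topology.FourManifolds.exists_commGroup_homotopySphereClass_of_ne_three` (named
  fact, NEW): Theorem 1.1 for DIFFEOMORPHISM classes in exactly the dimensions `n ≠ 0, 3, 4` that
  Kervaire–Milnor's Theorem 1.1 together with Smale's theorem cover (Remark p. 505: "for `n ≠ 3, 4`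
  … `Θₙ` can be described as the set of all diffeomorphism classes"; p. 507: `Θ₁ = Θ₂ = 0`, and
  "at present the structure of `Θ₃` remains unknown") — the tree's fact
  `exists_commGroup_homotopySphereClass` minus its instance `n = 3`, which is the Poincaré
  conjecture and is NOT in the cited sources. Proved: the tree's fact implies it
  (`…_of_ne_three_of`); it and spc4.S31 (Perelman) imply the tree's fact (`…_of_ne_three_of_three`);
  and it follows from SIX named facts none of which involves Perelman's theorem
  (`exists_commGroup_homotopySphereClass_of_ne_three_of_sixLeaves`: curves, surfaces,
  Whitehead–Hurewicz, the homotopy theory of Lemma 2.3, the rotation construction of Lemma 2.4,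
  Smale's h-cobordism theorem);
* `Literature.Topology.FourManifolds.exists_commGroup_homotopySphereClass_of_sevenLeaves`: the
  tree's fact from those six and spc4.S31.
* `HomotopySphere.contractibleSpace_compl_image_ball_of_leaves`,
  `HomotopySphere.nonempty_homotopyEquiv_sphere_of_isConnectedSum_of_leaves`: the named facts
  "a homotopy sphere with an open disc deleted is contractible" and "the sum of two homotopy
  spheres is a homotopy sphere" (p. 505) from the curves/surfaces facts and Whitehead–Hurewicz.

## References

* M. Kervaire, J. Milnor, *Groups of homotopy spheres I*, Ann. of Math. (2) 77 (1963), 504–537: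
  Thm 1.1 (p. 504), §2 pp. 505–507 (Lemmas 2.1–2.4, proof of Thm 1.1, the remarks on `Θ₁, Θ₂, Θ₃`
  on p. 507). doi:10.2307/1970128 [KervaireMilnorAnnals1963]
* J. Milnor, *Lectures on the h-cobordism theorem*, Princeton (1965), Thm 9.1. [MilnorHCobordism1965]
-/

open scoped Manifold ContDiff Topology ContinuousMap
open Set Module

noncomputable section

namespace Literature.Topology.FourManifolds

/-! ### Theorem 1.1 from the class-level facts and the Poincaré conjecture in dimensions `≤ 3` -/

/-- **Kervaire–Milnor's Theorem 1.1 for `Θₙ = HomotopySphereClass n`, `n ≠ 0, 4`, from its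
class-level inputs**, the low-dimensional input in minimal form: GIVEN that every homotopy
`n`-sphere with `1 ≤ n ≤ 3` is diffeomorphic to `𝕊ⁿ` (Kervaire–Milnor 1963, p. 507: `Θ₁ = Θ₂ = 0`
by the classification of curves and surfaces with Munkres–Whitehead, `Θ₃ = 0` under the Poincaré
hypothesis — Perelman's theorem) and the class-level Lemmas 2.1–2.4
(`HomotopySphereClass.GroupLawFacts n`) in every dimension `n ≥ 5`, the named fact
`exists_commGroup_homotopySphereClass` holds: for `n ≤ 3`, `Θₙ` is a point
(`HomotopySphereClass.subsingleton_of_nonempty_diffeomorph_sphere`,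
`HomotopySphereClass.exists_commGroup_of_subsingleton`); for `n ≥ 5`,
`HomotopySphereClass.GroupLawFacts.exists_commGroup`. Same proof as
`exists_commGroup_homotopySphereClass_of_groupLawFacts`, whose hypothesis spc4.S32 (all of the
dimensions `1, 2, 3, 5, 6, 12, 56, 61`) is stronger than what is used.
[cite: KervaireMilnorAnnals1963, Thm. 1.1, proof and remarks p. 507] -/
theorem exists_commGroup_homotopySphereClass_of_groupLawFacts'
    (hle3 : ∀ (n : ℕ) (S : HomotopySphere n), 1 ≤ n → n ≤ 3 →
      Nonempty (S.carrier ≃ₘ⟮𝓡 n, 𝓡 n⟯ (Metric.sphere (0 : EuclideanSpace ℝ (Fin (n + 1))) 1)))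
    (hhigh : ∀ n : ℕ, 5 ≤ n → HomotopySphereClass.GroupLawFacts n) :
    exists_commGroup_homotopySphereClass := by
  intro n h0 h4
  obtain ⟨o₀⟩ := (isOrientable_sphere_holds n : Nonempty _)
  by_cases h3 : n ≤ 3
  · haveI := HomotopySphereClass.subsingleton_of_nonempty_diffeomorph_sphere h0
      (fun S => hle3 n S (Nat.one_le_iff_ne_zero.mpr h0) h3)
    exact HomotopySphereClass.exists_commGroup_of_subsingleton o₀
  · exact (hhigh n (by omega)).exists_commGroup o₀

/-- **Homotopy spheres of dimension `1, 2, 3` are standard, given the smooth Poincaré conjecture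
in exactly these dimensions** (in Mathlib's form `ContinuousMap.HomotopyEquiv.NonemptyDiffeomorphSphere`,
for Hausdorff second countable manifolds): a homotopy sphere is such a manifold, homotopy
equivalent to `𝕊ⁿ` by definition. Kervaire–Milnor 1963, p. 507 (`Θ₁`, `Θ₂`; `Θ₃` modulo the
Poincaré hypothesis, now Perelman's theorem). Compare
`HomotopySphere.nonempty_diffeomorph_sphere_of_le_three_of`, which takes spc4.S32 instead.
[cite: KervaireMilnorAnnals1963, §2 p. 507] -/
theorem HomotopySphere.nonempty_diffeomorph_sphere_of_le_three_of'
    (hlow : ∀ n : ℕ, 1 ≤ n → n ≤ 3 → ∀ (M : Type) [TopologicalSpace M] [T2Space M]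
      [SecondCountableTopology M], ContinuousMap.HomotopyEquiv.NonemptyDiffeomorphSphere M n)
    (n : ℕ) (S : HomotopySphere n) (h1 : 1 ≤ n) (h3 : n ≤ 3) :
    Nonempty (S.carrier ≃ₘ⟮𝓡 n, 𝓡 n⟯ (Metric.sphere (0 : EuclideanSpace ℝ (Fin (n + 1))) 1)) := by
  obtain ⟨e⟩ := S.nonempty_homotopyEquiv
  exact hlow n h1 h3 S.carrier S.chartedSpace S.isManifold e

/-! ### Lemmas 2.3–2.4 with the ball removal fed in -/

/-- **`Σ # (-Σ)` is h-cobordant to `Sⁿ` (`n ≥ 2`), from three named facts** — Kervaire–Milnor's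
Lemmas 2.3 and 2.4 (*Groups of homotopy spheres I* (1963), pp. 506–507) for the tree, i.e. the
named fact `HomotopySphere.isHCobordant_sphere_of_isOrientedConnectedSum_neg`, GIVEN
(iii') the contractibility of a homotopy sphere with an open disc deleted
(`HomotopySphere.contractibleSpace_compl_image_ball`, which also yields the p. 505 remark that
sums of homotopy spheres are homotopy spheres, needed by Lemma 2.3 in dimension `2`),
(vii-b) the homotopy theory in the proof of Lemma 2.3
(`NullCobordism.isHomotopyEquiv_compl_ball_of_contractibleSpace`) and (vii-c) the rotation
construction in the proof of Lemma 2.4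
(`HomotopySphere.exists_nullCobordism_isOrientedConnectedSum_neg`). The fourth input of
`exists_commGroup_homotopySphereClass_of_leaves`, the ball removal (vii-a)
`NullCobordism.exists_cobordism_sphere_compl_ball`, is the tree theorem
`NullCobordism.exists_cobordism_sphere_homeomorph_compl_ball` (`BallRemovalCobordism.lean`, whose
statement is that of the fact verbatim; recorded as `NullCobordism.exists_cobordism_sphere_compl_ball_holds`
in `HomotopySpheresInverseProofs.lean`), fed into `isHCobordant_sphere_of_boundsContractible_of`,
and the Palais–Cerf uniqueness
needed to pass from the one sum of Lemma 2.4 to every sum is the tree theorem fed in by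
`HomotopySphere.boundsContractible_of_isOrientedConnectedSum_neg_of_exists'`.
[cite: KervaireMilnorAnnals1963, Lemmas 2.3–2.4 (pp. 506–507)] -/
theorem HomotopySphere.isHCobordant_sphere_of_isOrientedConnectedSum_neg_of_leaves
    (hKball : HomotopySphere.contractibleSpace_compl_image_ball)
    (h23b : NullCobordism.isHomotopyEquiv_compl_ball_of_contractibleSpace)
    (h24a : HomotopySphere.exists_nullCobordism_isOrientedConnectedSum_neg) :
    HomotopySphere.isHCobordant_sphere_of_isOrientedConnectedSum_neg :=
  HomotopySphere.isHCobordant_sphere_of_isOrientedConnectedSum_neg_of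
    (isHCobordant_sphere_of_boundsContractible_of
      (fun n M _ _ _ _ _ _ _ c => NullCobordism.exists_cobordism_sphere_homeomorph_compl_ball n M c)
      h23b)
    (HomotopySphere.boundsContractible_of_isOrientedConnectedSum_neg_of_exists'
      (HomotopySphere.exists_isOrientedConnectedSum_neg_boundsContractible_of h24a
        (HomotopySphere.contractibleSpace_compl_singleton_of_compl_image_ball hKball)))
    (HomotopySphere.nonempty_homotopyEquiv_sphere_of_isConnectedSum_of hKball)

/-! ### Assembly: five inputs -/

/-- **Kervaire–Milnor's Theorem 1.1 for `Θₙ = HomotopySphereClass n`, `n ≠ 0, 4`, from five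
inputs.** The named fact `exists_commGroup_homotopySphereClass` (the oriented-diffeomorphism
classes of homotopy `n`-spheres form an abelian group under connected sum, with unit `[𝕊ⁿ]` and
inverse `[Σ] ↦ [-Σ]`) follows from:
(i') the smooth Poincaré conjecture in dimensions `1, 2, 3` — every Hausdorff second countable
smooth `n`-manifold homotopy equivalent to `𝕊ⁿ`, `1 ≤ n ≤ 3`, is diffeomorphic to `𝕊ⁿ`
(classification of curves and surfaces with Munkres–Whitehead, Kervaire–Milnor p. 507; Perelman
for `n = 3`), used for `Θₙ`, `n ≤ 3`, and, in dimensions `1, 2`, for the contractibility of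
punctured homotopy spheres;
(iii'') simply connected acyclic manifolds are contractible
(`Literature.AlgebraicTopology.Homotopy.Manifold.contractibleSpace_of_simplyConnected_of_acyclic`;
Whitehead–Hurewicz), giving "the sum of two homotopy spheres is a homotopy sphere" (p. 505) and the
contractibility half of Lemma 2.4;
(vii-b) the homotopy theory in the proof of Lemma 2.3
(`NullCobordism.isHomotopyEquiv_compl_ball_of_contractibleSpace`: excision, Poincaré duality,
Whitehead);
(vii-c) the rotation construction in the proof of Lemma 2.4
(`HomotopySphere.exists_nullCobordism_isOrientedConnectedSum_neg`);
(viii) Smale's h-cobordism theorem (`nonempty_diffeomorph_of_isHCobordant_of_five_le`, spc4.S15;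
Kervaire–Milnor p. 505, Milnor 1965 Thm 9.1).
Everything else in the printed proof (§2, pp. 504–507: existence, uniqueness (Palais–Cerf), unit,
associativity and commutativity of oriented connected sums, the ball removal of Lemma 2.3, the
passage from Lemmas 2.3–2.4 to inverses, the group axioms, `Θₙ` for `n ≤ 3`) is proved in the
tree. [cite: KervaireMilnorAnnals1963, Thm. 1.1, §2 pp. 504–507] [cite: MilnorHCobordism1965, Thm. 9.1] -/
theorem exists_commGroup_homotopySphereClass_of_fiveLeaves
    (hlow : ∀ n : ℕ, 1 ≤ n → n ≤ 3 → ∀ (M : Type) [TopologicalSpace M] [T2Space M]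
      [SecondCountableTopology M], ContinuousMap.HomotopyEquiv.NonemptyDiffeomorphSphere M n)
    (hW : Literature.AlgebraicTopology.Homotopy.Manifold.contractibleSpace_of_simplyConnected_of_acyclic.{0})
    (h23b : NullCobordism.isHomotopyEquiv_compl_ball_of_contractibleSpace)
    (h24a : HomotopySphere.exists_nullCobordism_isOrientedConnectedSum_neg)
    (hS15 : FourManifolds.nonempty_diffeomorph_of_isHCobordant_of_five_le.{0}) :
    exists_commGroup_homotopySphereClass := by
  have hKball : HomotopySphere.contractibleSpace_compl_image_ball :=
    HomotopySphere.contractibleSpace_compl_image_ball_of hW fun n hn M _ _ _ => by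
      rcases hn with rfl | rfl
      · exact hlow 1 le_rfl (by norm_num) M
      · exact hlow 2 (by norm_num) (by norm_num) M
  exact exists_commGroup_homotopySphereClass_of_groupLawFacts'
    (HomotopySphere.nonempty_diffeomorph_sphere_of_le_three_of' hlow) fun n h5 =>
      HomotopySphereClass.groupLawFacts_of_fourFacts h5
        (HomotopySphere.nonempty_homotopyEquiv_sphere_of_isConnectedSum_of hKball)
        (HomotopySphere.isHCobordant_sphere_of_isOrientedConnectedSum_neg_of_leaves hKball h23b h24a)
        hS15

/-- **Theorem 1.1 for `Θₙ`, `n ≠ 0, 4`, from spc4.S32 and the four other inputs** — the form of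
`exists_commGroup_homotopySphereClass_of_leaves'` with the ball removal (vii-a) no longer a
hypothesis: (i) `nonemptyDiffeomorphSphere_of_mem` (spc4.S32, of which the dimensions `1, 2, 3`
are used), (iii'') `Manifold.contractibleSpace_of_simplyConnected_of_acyclic`, (vii-b)
`NullCobordism.isHomotopyEquiv_compl_ball_of_contractibleSpace`, (vii-c)
`HomotopySphere.exists_nullCobordism_isOrientedConnectedSum_neg`, (viii)
`nonempty_diffeomorph_of_isHCobordant_of_five_le` (spc4.S15).
[cite: KervaireMilnorAnnals1963, Thm. 1.1, §2 pp. 504–507] -/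
theorem exists_commGroup_homotopySphereClass_of_fiveLeaves'
    (h32 : FourManifolds.nonemptyDiffeomorphSphere_of_mem.{0})
    (hW : Literature.AlgebraicTopology.Homotopy.Manifold.contractibleSpace_of_simplyConnected_of_acyclic.{0})
    (h23b : NullCobordism.isHomotopyEquiv_compl_ball_of_contractibleSpace)
    (h24a : HomotopySphere.exists_nullCobordism_isOrientedConnectedSum_neg)
    (hS15 : FourManifolds.nonempty_diffeomorph_of_isHCobordant_of_five_le.{0}) :
    exists_commGroup_homotopySphereClass :=
  exists_commGroup_homotopySphereClass_of_fiveLeaves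
    (fun n h1 h3 M _ _ _ => h32 n (by interval_cases n <;> simp) M) hW h23b h24a hS15

/-! ### The p. 505 remark and the contractibility of punctured homotopy spheres from three leaves -/

/-- **A homotopy sphere with an open disc deleted is contractible, from three named facts**: the
named fact `HomotopySphere.contractibleSpace_compl_image_ball` (`HomotopySpheresSum.lean`; Kosinski
1993, VI §1; the contractibility half of Kervaire–Milnor's Lemma 2.4, p. 507) follows from the
classification of curves and surfaces in the form of the smooth Poincaré conjecture in dimensions
`1`, `2` (`nonemptyDiffeomorphSphere_one`, `nonemptyDiffeomorphSphere_two`, `SmoothPoincareLowDim.lean`)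
and the Whitehead–Hurewicz recognition of contractible manifolds
(`Literature.AlgebraicTopology.Homotopy.Manifold.contractibleSpace_of_simplyConnected_of_acyclic`,
dimensions `≥ 3`); the reduction is `HomotopySphere.contractibleSpace_compl_image_ball_of`
(`HomotopySpheresSumProofs.lean`) fed with `nonemptyDiffeomorphSphere_of_eq_one_or_eq_two`.
[cite: KervaireMilnorAnnals1963, Lemma 2.4, proof (p. 507)] [cite: Kosinski1993, Ch. VI §1] -/
theorem HomotopySphere.contractibleSpace_compl_image_ball_of_leaves
    (h1 : nonemptyDiffeomorphSphere_one.{0}) (h2 : nonemptyDiffeomorphSphere_two.{0})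
    (hW : Literature.AlgebraicTopology.Homotopy.Manifold.contractibleSpace_of_simplyConnected_of_acyclic.{0}) :
    HomotopySphere.contractibleSpace_compl_image_ball :=
  HomotopySphere.contractibleSpace_compl_image_ball_of hW
    (nonemptyDiffeomorphSphere_of_eq_one_or_eq_two h1 h2)

/-- **"The sum of two homotopy `n`-spheres is a homotopy `n`-sphere" from three named facts**:
Kervaire–Milnor's remark (*Groups of homotopy spheres I* (1963), §2, p. 505; named fact
`HomotopySphere.nonempty_homotopyEquiv_sphere_of_isConnectedSum`, all `n`) follows from
`nonemptyDiffeomorphSphere_one`, `nonemptyDiffeomorphSphere_two` and the Whitehead–Hurewicz fact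
`Manifold.contractibleSpace_of_simplyConnected_of_acyclic`, through
`HomotopySphere.contractibleSpace_compl_image_ball_of_leaves` and the suspension argument
`HomotopySphere.nonempty_homotopyEquiv_sphere_of_isConnectedSum_of` (`HomotopySpheresSum.lean`).
[cite: KervaireMilnorAnnals1963, §2 (p. 505)] -/
theorem HomotopySphere.nonempty_homotopyEquiv_sphere_of_isConnectedSum_of_leaves
    (h1 : nonemptyDiffeomorphSphere_one.{0}) (h2 : nonemptyDiffeomorphSphere_two.{0})
    (hW : Literature.AlgebraicTopology.Homotopy.Manifold.contractibleSpace_of_simplyConnected_of_acyclic.{0}) :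
    HomotopySphere.nonempty_homotopyEquiv_sphere_of_isConnectedSum :=
  HomotopySphere.nonempty_homotopyEquiv_sphere_of_isConnectedSum_of
    (HomotopySphere.contractibleSpace_compl_image_ball_of_leaves h1 h2 hW)

/-! ### Theorem 1.1 as printed, read through Smale's remark: the dimensions `n ≠ 3, 4` -/

/-- **Kervaire–Milnor's Theorem 1.1 for diffeomorphism classes, in the dimensions covered by the
source (`n ≠ 0, 3, 4`).** For `n ≠ 0, 3, 4` the type `Θₙ = HomotopySphereClass n` of oriented
homotopy `n`-spheres modulo orientation-preserving diffeomorphism carries a commutative group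
structure whose multiplication is the connected sum (`IsMul a b c → a * b = c`), whose unit is the
class of the standard sphere `𝕊ⁿ` with any orientation, and whose inverse is orientation
reversal. This is the tree's named fact `exists_commGroup_homotopySphereClass` (same three clauses,
stated there for all `n ≠ 0, 4`) MINUS its instance `n = 3`: Kervaire–Milnor prove Theorem 1.1 —
"the h-cobordism classes of homotopy `n`-spheres form an abelian group under the connected sum
operation" (p. 504) — for h-cobordism classes, and record (Remark, p. 505) that by Smale "two
homotopy `n`-spheres, `n ≠ 3, 4`, are h-cobordant if and only if they are diffeomorphic. Thus for
`n ≠ 3, 4` … the group `Θₙ` can be described as the set of all diffeomorphism classes"; for `n = 3`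
they state (p. 507) "If the Poincaré hypothesis were proved, it would follow that `Θ₃` is zero;
but at present the structure of `Θ₃` remains unknown." The `n = 3` instance of the tree's fact
(inverses in the DIFFEOMORPHISM quotient of homotopy `3`-spheres) is the Poincaré conjecture
(Perelman), which is not in the cited sources; the present statement is exactly what
Kervaire–Milnor's Theorem 1.1 with Smale's theorem give (dimensions `1, 2` by the classification
of curves and surfaces, p. 507), and it is the part that can be discharged without Perelman's
theorem (`exists_commGroup_homotopySphereClass_of_ne_three_of_sixLeaves`). Relations (proved):
`exists_commGroup_homotopySphereClass_of_ne_three_of` (the tree's fact implies this one) and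
`exists_commGroup_homotopySphereClass_of_ne_three_of_three` (this one and spc4.S31 give the tree's
fact). [cite: KervaireMilnorAnnals1963, Thm. 1.1 (p. 504), Remark p. 505, p. 507] [cite: MilnorHCobordism1965, Thm. 9.1] -/
def exists_commGroup_homotopySphereClass_of_ne_three : Prop :=
  ∀ (n : ℕ) (h0 : n ≠ 0) (h3 : n ≠ 3) (h4 : n ≠ 4),
    ∃ _ : CommGroup (HomotopySphereClass n),
      (∀ a b c : HomotopySphereClass n, HomotopySphereClass.IsMul a b c → a * b = c) ∧
      (∀ o : SmoothOrientation (𝓡 n) (Metric.sphere (0 : EuclideanSpace ℝ (Fin (n + 1))) 1),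
        (HomotopySphereClass.mk ⟨Metric.sphere (0 : EuclideanSpace ℝ (Fin (n + 1))) 1, o,
          ⟨.refl _⟩⟩ : HomotopySphereClass n) = 1) ∧
      ∀ a : HomotopySphereClass n, a⁻¹ = a.neg

/-- The tree's fact `exists_commGroup_homotopySphereClass` (all `n ≠ 0, 4`) implies its restriction
to `n ≠ 0, 3, 4` (Kervaire–Milnor 1963, Thm. 1.1 with the Remark p. 505). [cite: KervaireMilnorAnnals1963, Thm. 1.1 and Remark p. 505] -/
theorem exists_commGroup_homotopySphereClass_of_ne_three_of
    (h : exists_commGroup_homotopySphereClass) :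
    exists_commGroup_homotopySphereClass_of_ne_three :=
  fun n h0 _ h4 => h n h0 h4

/-- **The tree's fact from its `n ≠ 3` part and the Poincaré conjecture.** GIVEN Theorem 1.1 for
diffeomorphism classes in dimensions `n ≠ 0, 3, 4` (`exists_commGroup_homotopySphereClass_of_ne_three`)
and Perelman's theorem (spc4.S31, `nonempty_diffeomorph_sphere_three`: a closed simply connected
smooth `3`-manifold is diffeomorphic to `S³`), the named fact `exists_commGroup_homotopySphereClass`
holds: for `n = 3` every homotopy `3`-sphere is diffeomorphic to `𝕊³`
(`nonemptyDiffeomorphSphere_three_of`, `SmoothPoincareLowDim.lean`), so `Θ₃` is a point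
(`HomotopySphereClass.subsingleton_of_nonempty_diffeomorph_sphere`) and the trivial group does it
(`HomotopySphereClass.exists_commGroup_of_subsingleton`) — Kervaire–Milnor 1963, p. 507: "If the
Poincaré hypothesis were proved, it would follow that `Θ₃` is zero".
[cite: KervaireMilnorAnnals1963, §2 p. 507] [cite: MorganTian2007, Cor. 0.2 (a)] -/
theorem exists_commGroup_homotopySphereClass_of_ne_three_of_three
    (h : exists_commGroup_homotopySphereClass_of_ne_three)
    (h3 : FourManifolds.nonempty_diffeomorph_sphere_three.{0}) :
    exists_commGroup_homotopySphereClass := by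
  intro n h0 h4
  by_cases hn3 : n = 3
  · subst hn3
    obtain ⟨o₀⟩ := (isOrientable_sphere_holds 3 : Nonempty _)
    haveI := HomotopySphereClass.subsingleton_of_nonempty_diffeomorph_sphere (n := 3) h0 fun S => by
      obtain ⟨e⟩ := S.nonempty_homotopyEquiv
      exact nonemptyDiffeomorphSphere_three_of h3 S.carrier S.chartedSpace S.isManifold e
    exact HomotopySphereClass.exists_commGroup_of_subsingleton o₀
  · exact h n h0 hn3 h4

/-- **Theorem 1.1 for diffeomorphism classes in dimensions `n ≠ 0, 3, 4` from six named facts,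
none of which is the Poincaré conjecture**: (1)–(2) the classification of curves and surfaces in
the form of the smooth Poincaré conjecture in dimensions `1`, `2` (`nonemptyDiffeomorphSphere_one`,
`nonemptyDiffeomorphSphere_two`; Kervaire–Milnor p. 507: `Θ₁ = Θ₂ = 0`; also used, through
`HomotopySphere.contractibleSpace_compl_image_ball_of`, for "the sum of two homotopy spheres is a
homotopy sphere", p. 505), (3) simply connected acyclic manifolds are contractible
(`Literature.AlgebraicTopology.Homotopy.Manifold.contractibleSpace_of_simplyConnected_of_acyclic`;
Whitehead–Hurewicz), (4) the homotopy theory in the proof of Lemma 2.3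
(`NullCobordism.isHomotopyEquiv_compl_ball_of_contractibleSpace`), (5) the rotation construction
in the proof of Lemma 2.4 (`HomotopySphere.exists_nullCobordism_isOrientedConnectedSum_neg`),
(6) Smale's h-cobordism theorem (`nonempty_diffeomorph_of_isHCobordant_of_five_le`, spc4.S15).
Dimensions `1, 2`: `Θₙ` is a point; dimensions `≥ 5`: the class-level Lemmas 2.1–2.4
(`HomotopySphereClass.groupLawFacts_of_fourFacts`) and the algebra of Theorem 1.1
(`HomotopySphereClass.GroupLawFacts.exists_commGroup`).
[cite: KervaireMilnorAnnals1963, Thm. 1.1, §2 pp. 504–507] [cite: MilnorHCobordism1965, Thm. 9.1] -/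
theorem exists_commGroup_homotopySphereClass_of_ne_three_of_sixLeaves
    (h1 : nonemptyDiffeomorphSphere_one.{0}) (h2 : nonemptyDiffeomorphSphere_two.{0})
    (hW : Literature.AlgebraicTopology.Homotopy.Manifold.contractibleSpace_of_simplyConnected_of_acyclic.{0})
    (h23b : NullCobordism.isHomotopyEquiv_compl_ball_of_contractibleSpace)
    (h24a : HomotopySphere.exists_nullCobordism_isOrientedConnectedSum_neg)
    (hS15 : FourManifolds.nonempty_diffeomorph_of_isHCobordant_of_five_le.{0}) :
    exists_commGroup_homotopySphereClass_of_ne_three := by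
  have h12 := nonemptyDiffeomorphSphere_of_eq_one_or_eq_two h1 h2
  have hKball := HomotopySphere.contractibleSpace_compl_image_ball_of_leaves h1 h2 hW
  intro n h0 h3 h4
  obtain ⟨o₀⟩ := (isOrientable_sphere_holds n : Nonempty _)
  by_cases h2' : n ≤ 2
  · haveI := HomotopySphereClass.subsingleton_of_nonempty_diffeomorph_sphere h0 fun S => by
      obtain ⟨e⟩ := S.nonempty_homotopyEquiv
      exact h12 n (by omega) S.carrier S.chartedSpace S.isManifold e
    exact HomotopySphereClass.exists_commGroup_of_subsingleton o₀
  · exact (HomotopySphereClass.groupLawFacts_of_fourFacts (by omega)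
      (HomotopySphere.nonempty_homotopyEquiv_sphere_of_isConnectedSum_of hKball)
      (HomotopySphere.isHCobordant_sphere_of_isOrientedConnectedSum_neg_of_leaves hKball h23b h24a)
      hS15).exists_commGroup o₀

/-! ### Kervaire–Milnor's Theorem 1.1 (the tree's fact) from seven leaves -/

/-- **Kervaire–Milnor's Theorem 1.1 for `Θₙ = HomotopySphereClass n`, `n ≠ 0, 4` (the tree's
fact `exists_commGroup_homotopySphereClass`), from seven named facts, each an input of the printed
proof or of the passage to diffeomorphism classes**: the six of
`exists_commGroup_homotopySphereClass_of_ne_three_of_sixLeaves` — (1)–(2) the smooth Poincaré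
conjecture in dimensions `1`, `2` (`nonemptyDiffeomorphSphere_one`, `nonemptyDiffeomorphSphere_two`:
classification of curves and surfaces; Kervaire–Milnor p. 507), (3) Whitehead–Hurewicz
(`Literature.AlgebraicTopology.Homotopy.Manifold.contractibleSpace_of_simplyConnected_of_acyclic`),
(4) the homotopy theory of Lemma 2.3 (`NullCobordism.isHomotopyEquiv_compl_ball_of_contractibleSpace`),
(5) the rotation construction of Lemma 2.4 (`HomotopySphere.exists_nullCobordism_isOrientedConnectedSum_neg`),
(6) Smale's h-cobordism theorem (`nonempty_diffeomorph_of_isHCobordant_of_five_le`, spc4.S15) —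
and (7) the Poincaré conjecture (spc4.S31 `nonempty_diffeomorph_sphere_three`: Perelman,
Morgan–Tian Cor. 0.2 (a)) for the instance `n = 3`
(`exists_commGroup_homotopySphereClass_of_ne_three_of_three`). Equivalently:
`exists_commGroup_homotopySphereClass_of_fiveLeaves` fed with `nonemptyDiffeomorphSphere_of_le_three`
(`SmoothPoincareLowDim.lean`). All the differential topology of §2 — existence, uniqueness
(Palais–Cerf), unit, associativity, commutativity of oriented connected sums, the ball removal in
Lemma 2.3, inverses from Lemmas 2.3–2.4 and Smale, the group axioms, `Θₙ` for `n ≤ 3` — is proved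
in the tree (`HomotopySpheresGroup*.lean`, `OrientedConnectedSum*.lean`, `HomotopySpheresInverse*.lean`,
`BallRemovalCobordism.lean`, `RotationBody*.lean`). [cite: KervaireMilnorAnnals1963, Thm. 1.1, §2 pp. 504–507] [cite: MilnorHCobordism1965, Thm. 9.1] -/
theorem exists_commGroup_homotopySphereClass_of_sevenLeaves
    (h1 : nonemptyDiffeomorphSphere_one.{0}) (h2 : nonemptyDiffeomorphSphere_two.{0})
    (h3 : FourManifolds.nonempty_diffeomorph_sphere_three.{0})
    (hW : Literature.AlgebraicTopology.Homotopy.Manifold.contractibleSpace_of_simplyConnected_of_acyclic.{0})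
    (h23b : NullCobordism.isHomotopyEquiv_compl_ball_of_contractibleSpace)
    (h24a : HomotopySphere.exists_nullCobordism_isOrientedConnectedSum_neg)
    (hS15 : FourManifolds.nonempty_diffeomorph_of_isHCobordant_of_five_le.{0}) :
    exists_commGroup_homotopySphereClass :=
  exists_commGroup_homotopySphereClass_of_ne_three_of_three
    (exists_commGroup_homotopySphereClass_of_ne_three_of_sixLeaves h1 h2 hW h23b h24a hS15) h3

end Literature.Topology.FourManifolds
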